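import Summits.QuantumFields.BalabanUV.Beta.GAN24.FourFaceOneCovCoincident

/-!
# `BalabanUV.Beta.GAN24.FourFaceOneCovPlaquette` — binder row G-an2-4 ∕ (CONV-C), W-slot CT-route, (C)_0 ∕ (C)sym level-0 kernel programme
# (leaf-04 g65∕g66's `CSYM-LEVEL0-KERNEL-BLUEPRINT.md` §1 (III) ∕ §6 (L5) «the patterns (μα;μα) ∕ (μα;αμ) need the analogous one-plaquette
# residue count (NOT in the tree yet) — leaf-02's register»): **THE FOUR-FACE CHARGE OF A UNIT-COVARIANT TABLE ON CORNER SUPPORTS, EVERY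
# DIRECTION PATTERN AT ONCE — `N⁴ · fourFace_N (Y)(κ,κ′;a,b) = N^{4 − #{κ,κ′,a,b}} · zmode N Y`** (sequel of `FourFaceOneCov` ∕ `FourFaceOneCovCoincident`)

NOT IN PRINT; OUR BOOKKEEPING (G-an2-4 crux team (2), leaf prover `b2b-balaban-gan24-formalise-leaf-02`, gen 62; INTENT I-leaf02-g62-1).  HONEST FRAMING (cell
contract, verbatim): «discharging `BetaPertH` makes Bałaban's UV stability UNCONDITIONAL — a real constructive-QFT result; it is NOT the continuum limit and NOT the
Clay problem.»  HONEST DEPENDENCY (verbatim): «continuum YM on T⁴ ⇐ BetaPertH ∧ nine spine estimates (0/9 proved); BetaPertH ⇐ (D1) ∧ (D4) ∧ CAP+tail; G-an2-4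
gates asym, D1 and NE2/3/4.»  [folklore] residue counting; generic `d`, `1 ≤ N`; 0 `def`, 0 cited facts, 0 `def … : Prop`, 0 sorry.  Discharges NOTHING of (C) ∕
(C)sym ∕ (Q-L) ∕ `hcell` ∕ «T2Shape» ∕ «T2Drift» ∕ (hW, hWall); NEVER «G-an2-4 closed» as (CONV-C); NOT D1, NOT BetaPertH, NOT continuum, NOT Clay.

## What (`Y : Tab d`, `LocStencil₂ Y C δ`, `0 < δ`, UNIT-covariant; face directions `κ κ′ a b`, fibre entries `a′ b′`)
A one-plaquette bond configuration HANGS OFF ITS CORNER: every bond `(dir, pos)` of the plaquette `p_{μν}(c)`, `μ ≠ ν`, has `pos_{dir} = c_{dir}`.  So on one-plaquette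
supports the four face conditions `r_κ ≡ −1, (r+u′)_{κ′} ≡ −1, (r+x)_a ≡ −1, (r+z)_b ≡ −1` read `(r + c)_i ≡ −1` for `i ∈ {κ, κ′, a, b}` — a product filter pinning
exactly `#{κ,κ′,a,b}` coordinates, whatever the coincidences among the four directions.
* §1 `emod_add_congr`, `filter_box_face_eq_piFinset'` (the product structure of the face filter, NO distinctness hypothesis), `coordFilter_eq_of_corner`,
  **`card_faceFilter_of_corner`**: offsets with a common corner `c` (`c κ ≡ 0`, `c κ′ ≡ u′ κ′`, `c a ≡ x a`, `c b ≡ z b (mod N)`) ⇒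
  `#{r ∈ box : …} = N^{(d+1) − #{κ,κ′,a,b}}` — subsumes PART 3's `card_faceFilter_of_pairwise_ne` (`#S = 4`) and PART 3b's `card_faceFilter_of_coincident` on its support.
* §2 **`fourFace_mul_eq_pow_mul_zmode_of_cornerSupport`**: if the `(κ,κ′;a′,b′)`-slice of `Y` at the origin is CORNER-SUPPORTED
  (`Y κ 0 κ′ u′ x z a′ b′ ≠ 0 → ∃ c, c κ = 0 ∧ c κ′ = u′ κ′ ∧ c a = x a ∧ c b = z b`), then `N⁴ · fourFace = N^{4 − #{κ,κ′,a,b}} · zmode N Y κ κ′ a′ b′` —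
  ALL patterns: `N²` on two-direction patterns (the OWNER's R1 (N1) `9 = n²`; leaf-04's «plaquette-local table ⇒ contact ratio `L²`», R-leaf04-g64-1 (3)(b)),
  `N³` ∕ `N` ∕ `1` on one- ∕ three- ∕ four-direction patterns.
* §3 the two named two-direction patterns the blueprint asks for, with the corner eliminated: **`fourFace_mul_eq_sq_mul_zmode_par`** (`(κ,a;κ,a)`, support
  `x κ = 0 ∧ u′ a = z a`) and **`fourFace_mul_eq_sq_mul_zmode_cross`** (`(κ,a;a,κ)`, support `x a = u′ a ∧ z κ = 0`), `κ ≠ a` — siblings of PART 3b's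
  `fourFace_mul_eq_sq_mul_zmode_of_plaquetteSupport` (`(κ,κ;a,a)`, support `u′ κ = 0 ∧ x a = z a`).
The corner-support hypothesis for an3's `wilsonW₂ d T` (every `T` whose degenerate-cell class sums vanish — `wsym22 N`, `w22 N`) is the sibling file
`GAN24/WilsonBiStencilCornerSupport`.
-/

noncomputable section

open Finset
open scoped BigOperators
open Literature.MathematicalPhysics.QuantumFieldTheory
open Literature.MathematicalPhysics.QuantumFieldTheory.Balaban1983to89
open Literature.MathematicalPhysics.QuantumFieldTheory.Balaban1983to89.Beta
open ExpKernelCalculus (MKer shiftK)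
open AffineAveraging (Site box toSite)
open OneStepResolventKernel (Fib)
open BalabanCompositeJets (LocStencil₂)
open Summit.QuantumFields.BalabanUV.Beta.GAN24.BiStencilZeroMode (Tab zmode)
open Summit.QuantumFields.BalabanUV.Beta.GAN24.TaylorBlockSum (card_box)
open Summit.QuantumFields.BalabanUV.Beta.GAN24.ZeroModeCoarseCount (inner_const_of_unit_cov)
open Summit.QuantumFields.BalabanUV.Beta.GAN24.FourFaceOneCov (fourFace_eq_card_weighted card_filter_range_emod_succ)

namespace Summit.QuantumFields.BalabanUV.Beta.GAN24.FourFaceOneCovPlaquette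

variable {d : ℕ} {N : ℕ}

/-! ## §1 The residue count for four bonds hanging off a common corner -/

/-- [folklore] Shifts congruent mod `N` give the same shifted residue. -/
theorem emod_add_congr (m : ℤ) {e₁ e₂ : ℤ} (h : e₁ % (N : ℤ) = e₂ % (N : ℤ)) : (m + e₁) % (N : ℤ) = (m + e₂) % (N : ℤ) := by
  rw [Int.add_emod, h, ← Int.add_emod]

/-- [folklore] **THE FACE FILTER OF THE BOX IS A PRODUCT OF COORDINATE FILTERS** — for EVERY direction pattern (no distinctness needed: a coordinate may carry
several of the four conditions). -/
theorem filter_box_face_eq_piFinset' (N : ℕ) (κ κ' a b : Fin (d + 1)) (u' x z : Site (d + 1)) :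
    (box (d + 1) N).filter (fun rr => toSite rr κ % (N : ℤ) = (N : ℤ) - 1 ∧ (toSite rr + u') κ' % (N : ℤ) = (N : ℤ) - 1 ∧
        (toSite rr + x) a % (N : ℤ) = (N : ℤ) - 1 ∧ (toSite rr + z) b % (N : ℤ) = (N : ℤ) - 1)
      = Fintype.piFinset (fun i => (Finset.range N).filter (fun m : ℕ =>
          (i = κ → ((m : ℤ)) % (N : ℤ) = (N : ℤ) - 1) ∧ (i = κ' → ((m : ℤ) + u' κ') % (N : ℤ) = (N : ℤ) - 1) ∧
          (i = a → ((m : ℤ) + x a) % (N : ℤ) = (N : ℤ) - 1) ∧ (i = b → ((m : ℤ) + z b) % (N : ℤ) = (N : ℤ) - 1))) := by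
  ext rr
  simp only [Finset.mem_filter, AffineAveraging.box, Fintype.mem_piFinset, Finset.mem_range, toSite, Pi.add_apply]
  constructor
  · rintro ⟨hbox, h1, h2, h3, h4⟩ i
    refine ⟨hbox i, ?_, ?_, ?_, ?_⟩
    · rintro rfl; exact h1
    · rintro rfl; exact h2
    · rintro rfl; exact h3
    · rintro rfl; exact h4
  · intro h
    exact ⟨fun i => (h i).1, (h κ).2.1 rfl, (h κ').2.2.1 rfl, (h a).2.2.2.1 rfl, (h b).2.2.2.2 rfl⟩

/-- [folklore] **WITH A COMMON CORNER EVERY COORDINATE CARRIES ONE CONDITION OR NONE**: if `c κ ≡ 0`, `c κ′ ≡ u′ κ′`, `c a ≡ x a`, `c b ≡ z b (mod N)`, the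
conjunction of the (up to four) face conditions on coordinate `i` is `i ∈ {κ,κ′,a,b} → (m + c i) % N = N − 1`. -/
theorem coordFilter_eq_of_corner {κ κ' a b : Fin (d + 1)} {u' x z c : Site (d + 1)} (hcκ : c κ % (N : ℤ) = 0)
    (hcκ' : c κ' % (N : ℤ) = u' κ' % (N : ℤ)) (hca : c a % (N : ℤ) = x a % (N : ℤ)) (hcb : c b % (N : ℤ) = z b % (N : ℤ)) (i : Fin (d + 1)) :
    (Finset.range N).filter (fun m : ℕ =>
        (i = κ → ((m : ℤ)) % (N : ℤ) = (N : ℤ) - 1) ∧ (i = κ' → ((m : ℤ) + u' κ') % (N : ℤ) = (N : ℤ) - 1) ∧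
          (i = a → ((m : ℤ) + x a) % (N : ℤ) = (N : ℤ) - 1) ∧ (i = b → ((m : ℤ) + z b) % (N : ℤ) = (N : ℤ) - 1))
      = (Finset.range N).filter (fun m : ℕ => i ∈ ({κ, κ', a, b} : Finset (Fin (d + 1))) → ((m : ℤ) + c i) % (N : ℤ) = (N : ℤ) - 1) := by
  ext m
  simp only [Finset.mem_filter, Finset.mem_range, Finset.mem_insert, Finset.mem_singleton, and_congr_right_iff]
  intro _
  -- the four conditions rewritten against the corner
  have eκ : ((m : ℤ)) % (N : ℤ) = ((m : ℤ) + c κ) % (N : ℤ) := by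
    have h0 : (0 : ℤ) % (N : ℤ) = c κ % (N : ℤ) := by rw [hcκ, Int.zero_emod]
    simpa only [add_zero] using emod_add_congr (N := N) (m : ℤ) h0
  have eκ' : ((m : ℤ) + u' κ') % (N : ℤ) = ((m : ℤ) + c κ') % (N : ℤ) := emod_add_congr (N := N) (m : ℤ) hcκ'.symm
  have ea : ((m : ℤ) + x a) % (N : ℤ) = ((m : ℤ) + c a) % (N : ℤ) := emod_add_congr (N := N) (m : ℤ) hca.symm
  have eb : ((m : ℤ) + z b) % (N : ℤ) = ((m : ℤ) + c b) % (N : ℤ) := emod_add_congr (N := N) (m : ℤ) hcb.symm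
  constructor
  · rintro ⟨h1, h2, h3, h4⟩ hi
    rcases hi with rfl | rfl | rfl | rfl
    · rw [← eκ]; exact h1 rfl
    · rw [← eκ']; exact h2 rfl
    · rw [← ea]; exact h3 rfl
    · rw [← eb]; exact h4 rfl
  · intro h
    refine ⟨?_, ?_, ?_, ?_⟩
    · rintro rfl; rw [eκ]; exact h (Or.inl rfl)
    · rintro rfl; rw [eκ']; exact h (Or.inr (Or.inl rfl))
    · rintro rfl; rw [ea]; exact h (Or.inr (Or.inr (Or.inl rfl)))
    · rintro rfl; rw [eb]; exact h (Or.inr (Or.inr (Or.inr rfl)))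

/-- [folklore] At most four directions. -/
theorem card_pattern_le_four (κ κ' a b : Fin (d + 1)) : ({κ, κ', a, b} : Finset (Fin (d + 1))).card ≤ 4 := by
  have h1 := Finset.card_insert_le κ ({κ', a, b} : Finset (Fin (d + 1)))
  have h2 := Finset.card_insert_le κ' ({a, b} : Finset (Fin (d + 1)))
  have h3 := Finset.card_insert_le a ({b} : Finset (Fin (d + 1)))
  rw [Finset.card_singleton] at h3
  omega

/-- [folklore] … and at most `d + 1` of them. -/
theorem card_pattern_le_dim (κ κ' a b : Fin (d + 1)) : ({κ, κ', a, b} : Finset (Fin (d + 1))).card ≤ d + 1 := by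
  simpa only [Fintype.card_fin] using Finset.card_le_univ ({κ, κ', a, b} : Finset (Fin (d + 1)))

/-- NOT IN PRINT; OUR BOOKKEEPING.  **THE COUNT FOR FOUR BONDS HANGING OFF A COMMON CORNER** (`1 ≤ N`; ANY direction pattern `κ κ′ a b`; offsets `u′ x z` and a
site `c` with `c κ ≡ 0`, `c κ′ ≡ u′ κ′`, `c a ≡ x a`, `c b ≡ z b (mod N)`):
`#{r ∈ box : r_κ ≡ N−1, (r+u′)_{κ′} ≡ N−1, (r+x)_a ≡ N−1, (r+z)_b ≡ N−1} = N^{(d+1) − #{κ,κ′,a,b}}` — the coordinates in `{κ,κ′,a,b}` are pinned to one residue each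
(all their conditions agree through the corner), the others are free.  PART 3's pairwise-distinct count and PART 3b's coincident count are the cases `#S = 4`
and `(κ,κ;a,a)`. -/
theorem card_faceFilter_of_corner (hN : 1 ≤ N) {κ κ' a b : Fin (d + 1)} {u' x z c : Site (d + 1)} (hcκ : c κ % (N : ℤ) = 0)
    (hcκ' : c κ' % (N : ℤ) = u' κ' % (N : ℤ)) (hca : c a % (N : ℤ) = x a % (N : ℤ)) (hcb : c b % (N : ℤ) = z b % (N : ℤ)) :
    ((box (d + 1) N).filter (fun rr => toSite rr κ % (N : ℤ) = (N : ℤ) - 1 ∧ (toSite rr + u') κ' % (N : ℤ) = (N : ℤ) - 1 ∧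
        (toSite rr + x) a % (N : ℤ) = (N : ℤ) - 1 ∧ (toSite rr + z) b % (N : ℤ) = (N : ℤ) - 1)).card
      = N ^ (d + 1 - ({κ, κ', a, b} : Finset (Fin (d + 1))).card) := by
  rw [filter_box_face_eq_piFinset' N κ κ' a b u' x z, Fintype.card_piFinset]
  rw [Finset.prod_congr rfl fun i _ => by rw [coordFilter_eq_of_corner hcκ hcκ' hca hcb i]]
  have hcoord : ∀ i : Fin (d + 1),
      ((Finset.range N).filter (fun m : ℕ => i ∈ ({κ, κ', a, b} : Finset (Fin (d + 1))) → ((m : ℤ) + c i) % (N : ℤ) = (N : ℤ) - 1)).card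
        = if i ∈ ({κ, κ', a, b} : Finset (Fin (d + 1))) then 1 else N := by
    intro i
    by_cases hi : i ∈ ({κ, κ', a, b} : Finset (Fin (d + 1)))
    · rw [if_pos hi]
      have e : (Finset.range N).filter (fun m : ℕ => i ∈ ({κ, κ', a, b} : Finset (Fin (d + 1))) → ((m : ℤ) + c i) % (N : ℤ) = (N : ℤ) - 1)
          = (Finset.range N).filter (fun m : ℕ => ((m : ℤ) + c i) % (N : ℤ) = (N : ℤ) - 1) := by
        ext m
        simp only [Finset.mem_filter, Finset.mem_range, hi, true_implies]
      rw [e]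
      exact card_filter_range_emod_succ hN (c i)
    · rw [if_neg hi]
      have e : (Finset.range N).filter (fun m : ℕ => i ∈ ({κ, κ', a, b} : Finset (Fin (d + 1))) → ((m : ℤ) + c i) % (N : ℤ) = (N : ℤ) - 1)
          = Finset.range N := Finset.filter_true_of_mem fun m _ h => absurd h hi
      rw [e, Finset.card_range]
  simp_rw [hcoord]
  rw [Finset.prod_ite, Finset.prod_const_one, one_mul, Finset.prod_const]
  congr 1
  rw [Finset.filter_not, Finset.card_sdiff_of_subset (Finset.filter_subset _ _), Finset.card_univ, Fintype.card_fin,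
    Finset.filter_mem_eq_inter, Finset.univ_inter]

/-! ## §2 On corner supports the four-face charge is `N^{−#S}` of the cell charge -/

/-- NOT IN PRINT; OUR BOOKKEEPING.  **ON A CORNER-SUPPORTED SLICE, `N⁴ · fourFace_N (Y)(κ,κ′;a,b) = N^{4 − #{κ,κ′,a,b}} · zmode N Y κ κ′ a′ b′`** for every
unit-covariant `LocStencil₂` table (`0 < δ`, `1 ≤ N`, ANY direction pattern).  CORNER SUPPORT of the slice at the origin: a non-zero entry at second bond `(κ′, u′)`
and legs `(a, x)`, `(b, z)` forces a site `c` with `c κ = 0`, `c κ′ = u′ κ′`, `c a = x a`, `c b = z b` — the geometry of the four bonds of one plaquette seen from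
its corner (an3's `wilsonW₂`: the sibling file `WilsonBiStencilCornerSupport`).  Then the count of §1 is the constant `N^{(d+1) − #S}` on the support, the slice at the
origin is the constant slice charge (leaf-16's `inner_const_of_unit_cov`), and `N⁴ · N^{(d+1)−#S} · slice = N^{4−#S} · N^{d+1} · slice = N^{4−#S} · zmode N Y`. -/
theorem fourFace_mul_eq_pow_mul_zmode_of_cornerSupport (hN : 1 ≤ N) {Y : Tab d} {C δ : ℝ} (hY : LocStencil₂ Y C δ) (hδ : 0 < δ)
    (h1 : ∀ κ u κ' u' t, Y κ (u + t) κ' (u' + t) = shiftK (-t) (Y κ u κ' u')) (κ κ' a b : Fin (d + 1)) (a' b' : Fib d)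
    (hsupp : ∀ u' x z : Site (d + 1), Y κ 0 κ' u' x z a' b' ≠ 0 → ∃ c : Site (d + 1), c κ = 0 ∧ c κ' = u' κ' ∧ c a = x a ∧ c b = z b) :
    (N : ℝ) ^ 4 * ∑ rr ∈ box (d + 1) N, ∑' u' : Site (d + 1), ∑' x : Site (d + 1), ∑' z : Site (d + 1),
        (if toSite rr κ % (N : ℤ) = (N : ℤ) - 1 ∧ u' κ' % (N : ℤ) = (N : ℤ) - 1 ∧ x a % (N : ℤ) = (N : ℤ) - 1 ∧ z b % (N : ℤ) = (N : ℤ) - 1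
          then Y κ (toSite rr) κ' u' x z a' b' else 0)
      = (N : ℝ) ^ (4 - ({κ, κ', a, b} : Finset (Fin (d + 1))).card) * zmode N Y κ κ' a' b' := by
  rw [fourFace_eq_card_weighted N hY hδ h1 κ κ' a b a' b']
  -- on the support the count is the constant `N^{(d+1) − #S}`; off the support both sides vanish
  have e : ∀ u' x z : Site (d + 1),
      (((box (d + 1) N).filter (fun rr => toSite rr κ % (N : ℤ) = (N : ℤ) - 1 ∧ (toSite rr + u') κ' % (N : ℤ) = (N : ℤ) - 1 ∧
          (toSite rr + x) a % (N : ℤ) = (N : ℤ) - 1 ∧ (toSite rr + z) b % (N : ℤ) = (N : ℤ) - 1)).card : ℝ) * Y κ 0 κ' u' x z a' b'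
        = (N : ℝ) ^ (d + 1 - ({κ, κ', a, b} : Finset (Fin (d + 1))).card) * Y κ 0 κ' u' x z a' b' := by
    intro u' x z
    by_cases hY0 : Y κ 0 κ' u' x z a' b' = 0
    · rw [hY0, mul_zero, mul_zero]
    · obtain ⟨c, hcκ, hcκ', hca, hcb⟩ := hsupp u' x z hY0
      rw [card_faceFilter_of_corner hN (c := c) (by rw [hcκ, Int.zero_emod]) (by rw [hcκ']) (by rw [hca]) (by rw [hcb])]
      push_cast
      rfl
  simp_rw [e, tsum_mul_left]
  -- the cell charge is `N^{d+1}` slices at the origin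
  unfold zmode
  rw [Finset.sum_congr rfl fun rr _ => inner_const_of_unit_cov h1 κ κ' a' b' (toSite rr), Finset.sum_const, card_box, nsmul_eq_mul]
  push_cast
  rw [← mul_assoc, ← pow_add, ← mul_assoc, ← pow_add]
  have h4 := card_pattern_le_four κ κ' a b
  have hD := card_pattern_le_dim κ κ' a b
  congr 2
  omega

/-! ## §3 The two-direction patterns `(κ,a;κ,a)` and `(κ,a;a,κ)` with the corner eliminated -/

/-- [folklore] The two-direction patterns have `#{κ,a,κ,a} = #{κ,a,a,κ} = 2` (`κ ≠ a`). -/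
theorem card_pattern_par {κ a : Fin (d + 1)} (hκa : κ ≠ a) : ({κ, a, κ, a} : Finset (Fin (d + 1))).card = 2 := by
  have e : ({κ, a, κ, a} : Finset (Fin (d + 1))) = {κ, a} := by
    ext i
    simp only [Finset.mem_insert, Finset.mem_singleton]
    tauto
  rw [e, Finset.card_pair hκa]

/-- [folklore] (idem, the crossed pattern). -/
theorem card_pattern_cross {κ a : Fin (d + 1)} (hκa : κ ≠ a) : ({κ, a, a, κ} : Finset (Fin (d + 1))).card = 2 := by
  have e : ({κ, a, a, κ} : Finset (Fin (d + 1))) = {κ, a} := by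
    ext i
    simp only [Finset.mem_insert, Finset.mem_singleton]
    tauto
  rw [e, Finset.card_pair hκa]

/-- NOT IN PRINT; OUR BOOKKEEPING.  **THE PARALLEL PATTERN `(κ,a;κ,a)`, `κ ≠ a`: `N⁴ · fourFace = N² · zmode`** on one-plaquette supports — the first leg is a
`κ`-bond like the first source bond (so `x κ = 0`), the second leg an `a`-bond like the second source bond (so `u′ a = z a`); unit-covariant `LocStencil₂` `Y`,
`0 < δ`, `1 ≤ N`.  (The blueprint's «(μα;μα)».) -/
theorem fourFace_mul_eq_sq_mul_zmode_par (hN : 1 ≤ N) {Y : Tab d} {C δ : ℝ} (hY : LocStencil₂ Y C δ) (hδ : 0 < δ)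
    (h1 : ∀ κ u κ' u' t, Y κ (u + t) κ' (u' + t) = shiftK (-t) (Y κ u κ' u')) {κ a : Fin (d + 1)} (hκa : κ ≠ a) (a' b' : Fib d)
    (hsupp : ∀ u' x z : Site (d + 1), Y κ 0 a u' x z a' b' ≠ 0 → x κ = 0 ∧ u' a = z a) :
    (N : ℝ) ^ 4 * ∑ rr ∈ box (d + 1) N, ∑' u' : Site (d + 1), ∑' x : Site (d + 1), ∑' z : Site (d + 1),
        (if toSite rr κ % (N : ℤ) = (N : ℤ) - 1 ∧ u' a % (N : ℤ) = (N : ℤ) - 1 ∧ x κ % (N : ℤ) = (N : ℤ) - 1 ∧ z a % (N : ℤ) = (N : ℤ) - 1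
          then Y κ (toSite rr) a u' x z a' b' else 0)
      = (N : ℝ) ^ 2 * zmode N Y κ a a' b' := by
  have hc : ∀ u' x z : Site (d + 1), Y κ 0 a u' x z a' b' ≠ 0 → ∃ c : Site (d + 1), c κ = 0 ∧ c a = u' a ∧ c κ = x κ ∧ c a = z a := by
    intro u' x z h
    obtain ⟨hx, huz⟩ := hsupp u' x z h
    exact ⟨fun i => if i = a then u' a else 0, by simp [hκa], by simp, by simp [hκa, hx], by simp [huz]⟩
  rw [fourFace_mul_eq_pow_mul_zmode_of_cornerSupport hN hY hδ h1 κ a κ a a' b' hc, card_pattern_par hκa]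

/-- NOT IN PRINT; OUR BOOKKEEPING.  **THE CROSSED PATTERN `(κ,a;a,κ)`, `κ ≠ a`: `N⁴ · fourFace = N² · zmode`** on one-plaquette supports — the first leg is an
`a`-bond like the second source bond (`x a = u′ a`), the second leg a `κ`-bond like the first source bond (`z κ = 0`).  (The blueprint's «(μα;αμ)».) -/
theorem fourFace_mul_eq_sq_mul_zmode_cross (hN : 1 ≤ N) {Y : Tab d} {C δ : ℝ} (hY : LocStencil₂ Y C δ) (hδ : 0 < δ)
    (h1 : ∀ κ u κ' u' t, Y κ (u + t) κ' (u' + t) = shiftK (-t) (Y κ u κ' u')) {κ a : Fin (d + 1)} (hκa : κ ≠ a) (a' b' : Fib d)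
    (hsupp : ∀ u' x z : Site (d + 1), Y κ 0 a u' x z a' b' ≠ 0 → x a = u' a ∧ z κ = 0) :
    (N : ℝ) ^ 4 * ∑ rr ∈ box (d + 1) N, ∑' u' : Site (d + 1), ∑' x : Site (d + 1), ∑' z : Site (d + 1),
        (if toSite rr κ % (N : ℤ) = (N : ℤ) - 1 ∧ u' a % (N : ℤ) = (N : ℤ) - 1 ∧ x a % (N : ℤ) = (N : ℤ) - 1 ∧ z κ % (N : ℤ) = (N : ℤ) - 1
          then Y κ (toSite rr) a u' x z a' b' else 0)
      = (N : ℝ) ^ 2 * zmode N Y κ a a' b' := by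
  have hc : ∀ u' x z : Site (d + 1), Y κ 0 a u' x z a' b' ≠ 0 → ∃ c : Site (d + 1), c κ = 0 ∧ c a = u' a ∧ c a = x a ∧ c κ = z κ := by
    intro u' x z h
    obtain ⟨hx, hz⟩ := hsupp u' x z h
    exact ⟨fun i => if i = a then u' a else 0, by simp [hκa], by simp, by simp [hx], by simp [hκa, hz]⟩
  rw [fourFace_mul_eq_pow_mul_zmode_of_cornerSupport hN hY hδ h1 κ a a κ a' b' hc, card_pattern_cross hκa]

end Summit.QuantumFields.BalabanUV.Beta.GAN24.FourFaceOneCovPlaquette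

end
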